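import Summits.Ventures.CertifiedArithmetic.LowPrec.SRFormatsBridge
import Summits.Ventures.CertifiedArithmetic.LowPrec.SRHoeffdingFormats
import Summits.Ventures.CertifiedArithmetic.LowPrec.SRHoeffdingInnerProduct
import Summits.Ventures.CertifiedArithmetic.LowPrec.SRLimitedBits
import HarnessLib

/-!
# Rung R3 beyond `R3_SRSumUnbiased`: the accumulation-level SR statements as venture Props, discharged

HONEST FRAMING: certified error envelopes and provably optimal rounding/accumulation schemes for
low-precision formats under stated cost models; every table by two implementations; no hardware or
vendor claims.

`Summits/Ventures/CertifiedArithmetic/Statement.lean` states `R3_SROneStep` and `R3_SRSumUnbiased` and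
says the accumulation-level SR statements beyond them are appended by the sr seat.  This file states
them in the same shape — `Prop`s quantifying over ALL data of a format `φ` through the substrate value
set `MiniFloat.valueSet φ` (true representable set incl. subnormals; saturation explicit in the model;
no standard-model assumption) — and inhabits each by a landed theorem (no new mathematics here):

* `R3_SRSumVariance` — exact variance identity under `NoSat` (martingale structure, no independence);
* `R3_SRSumEnvelope φ G` — `GapLE G ⇒ accVar ≤ nG²/4`, and under `NoSat` the sure bound `nG` and the
  Chebyshev `√n` law; `R3_SRSpacing φ G` — `GapLE G` for every input (kernel successor certificates:
  E2M1 2, E3M2 4, E2M3 1/2, E4M3 32, E5M2-finite 8192);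
* `R3_SRSumExpTail φ G` — the exponential (Azuma–Hoeffding) tail `2·exp(−2t²/(nG²))`;
* `R3_SRInnerProduct φ Gp Gs` — two-stage SR inner products: unbiased under `IPNoSat`, exact variance
  identity, `ipVar ≤ n(Gp²+Gs²)/4`, Chebyshev;
* `R3_SRLimitedBitsBias φ N` — P3109 StochasticA/B/C with `N` random bits: `|bias| ≤ nG·2^{-N}` (A),
  `nG·2^{-(N+1)}` (B, C) under `NoSat ∧ GapLE G`.
-/

namespace Summit.Ventures.CertifiedArithmetic

open Literature.ComputerArithmetic.FloatingPoint
open Literature.ComputerArithmetic.FloatingPoint.MiniFloat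
open Literature.ComputerArithmetic.FloatingPoint.Format
open Summit.Ventures.CertifiedArithmetic.LowPrec
open Finset

/-! ### Exact variance -/

/-- R3 (exact variance of recursive SR summation): absent saturation, for every shift `a`,
`E_s (ŝₙ − a)² = accVar + (s + ∑xₖ − a)²`, where `accVar` is the expected sum of the conditional
one-step variances `(⌈c̄⌉ − c̄)(c̄ − ⌊c̄⌋)` along the outcome tree (rounding errors are martingale
differences; independence is neither assumed nor true).
PROVED (sr seat): `LowPrec.SR.accExp_sq_sub` (SRAccumulation.lean). -/
def R3_SRSumVariance (φ : Format) : Prop :=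
  ∀ (x : ℕ → ℚ) (n : ℕ) (s a : ℚ), SR.NoSat (valueSet φ) x n s →
    SR.accExp (valueSet φ) x n (fun t => (t - a) ^ 2) s
      = SR.accVar (valueSet φ) x n s + (s + ∑ k ∈ range n, x k - a) ^ 2

/-- `R3_SRSumVariance`: PROVED for every format. -/
theorem R3_SRSumVariance_holds (φ : Format) : R3_SRSumVariance φ :=
  fun x n s a h => SR.accExp_sq_sub _ x n s h a

/-! ### Envelopes from a spacing bound -/

/-- R3 (√n envelope from a spacing bound `G`): if every candidate gap met along the outcome tree is
`≤ G` then `accVar ≤ n G²/4`; if moreover no branch saturates, then surely `|ŝₙ − s − ∑xₖ| ≤ nG` and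
`P(|ŝₙ − s − ∑xₖ| ≥ t) ≤ nG²/(4t²)` for every `t > 0`.
PROVED (sr seat): `LowPrec.SR.accVar_le`, `allOutcomes_abs_sub_le`, `prob_dev_ge_le` (SREnvelopes.lean). -/
def R3_SRSumEnvelope (φ : Format) (G : ℚ) : Prop :=
  ∀ (x : ℕ → ℚ) (n : ℕ) (s : ℚ), SR.GapLE (valueSet φ) G x n s →
    SR.accVar (valueSet φ) x n s ≤ n * G ^ 2 / 4 ∧
    (SR.NoSat (valueSet φ) x n s →
      SR.AllOutcomes (valueSet φ) x n (fun v => |v - (s + ∑ k ∈ range n, x k)| ≤ n * G) s ∧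
      ∀ t : ℚ, 0 < t →
        SR.accExp (valueSet φ) x n (SR.devInd t (s + ∑ k ∈ range n, x k)) s
          ≤ n * G ^ 2 / (4 * t ^ 2))

/-- `R3_SRSumEnvelope`: PROVED for every format and every `G`. -/
theorem R3_SRSumEnvelope_holds (φ : Format) (G : ℚ) : R3_SRSumEnvelope φ G :=
  fun x n s hg => ⟨SR.accVar_le _ G x n s hg, fun h =>
    ⟨SR.allOutcomes_abs_sub_le _ G x n s h hg, fun _ ht => SR.prob_dev_ge_le _ G x n s h hg ht⟩⟩

/-- R3 (format spacing): the candidate gap of EVERY pre-rounding value on EVERY branch is `≤ G` —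
i.e. `G` bounds the spacing of the (finite) value set, so the envelopes above need no path hypothesis
besides `NoSat`. -/
def R3_SRSpacing (φ : Format) (G : ℚ) : Prop :=
  ∀ (x : ℕ → ℚ) (n : ℕ) (s : ℚ), SR.GapLE (valueSet φ) G x n s

/-- `R3_SRSpacing`: PROVED with the top-binade spacings E2M1 `2`, E3M2 `4`, E2M3 `1/2`, E4M3 `32`,
E5M2 (finite part) `8192`, from the kernel-checked successor certificates of the literals and the
kernel-checked identification literal = `valueSet` (SRFormatsBridge.lean). -/
theorem R3_SRSpacing_formats :
    R3_SRSpacing E2M1 2 ∧ R3_SRSpacing E3M2 4 ∧ R3_SRSpacing E2M3 (1 / 2) ∧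
    R3_SRSpacing E4M3 32 ∧ R3_SRSpacing E5M2 8192 := by
  refine ⟨fun x n s => ?_, fun x n s => ?_, fun x n s => ?_, fun x n s => ?_, fun x n s => ?_⟩
  · rw [← SR.e2m1_eq_valueSet]
    exact SR.gapLE_of_succ SR.FP4.e2m1_nonempty (G := 2) (by norm_num) SR.FP4.e2m1_succ x n s
  · rw [← SR.e3m2_eq_valueSet]
    exact SR.gapLE_of_succ SR.Formats.e3m2_nonempty (G := 4) (by norm_num) SR.Formats.e3m2_succ x n s
  · rw [← SR.e2m3_eq_valueSet]
    exact SR.gapLE_of_succ SR.Formats.e2m3_nonempty (G := 1 / 2) (by norm_num)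
      SR.Formats.e2m3_succ x n s
  · rw [← SR.e4m3_eq_valueSet]
    exact SR.gapLE_of_succ SR.Formats.e4m3_nonempty (G := 32) (by norm_num) SR.Formats.e4m3_succ x n s
  · rw [← SR.e5m2_eq_valueSet]
    exact SR.gapLE_of_succ SR.Formats.e5m2_nonempty (G := 8192) (by norm_num)
      SR.Formats.e5m2_succ x n s

/-! ### Exponential tail -/

/-- R3 (martingale concentration, exponential form): under `NoSat ∧ GapLE G`, for every `t > 0`,
`P(|ŝₙ − s − ∑xₖ| ≥ t) ≤ 2·exp(−2t²/(nG²))` — the finite-format absolute-error form of the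
Connolly–Higham–Mary Azuma–Hoeffding bound (the rational, exactly computed probability on the left is
cast to `ℝ`).
PROVED (sr seat): `LowPrec.SR.prob_dev_ge_le_exp_rat` (SRHoeffdingFormats.lean, from `accExp_exp_le`,
SRHoeffding.lean). -/
def R3_SRSumExpTail (φ : Format) (G : ℚ) : Prop :=
  ∀ (x : ℕ → ℚ) (n : ℕ) (s : ℚ), SR.NoSat (valueSet φ) x n s → SR.GapLE (valueSet φ) G x n s →
    ∀ t : ℚ, 0 < t →
      ((SR.accExp (valueSet φ) x n (SR.devInd t (s + ∑ k ∈ range n, x k)) s : ℚ) : ℝ)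
        ≤ 2 * Real.exp (-2 * (t : ℝ) ^ 2 / (n * (G : ℝ) ^ 2))

/-- `R3_SRSumExpTail`: PROVED for every format and every `G`. -/
theorem R3_SRSumExpTail_holds (φ : Format) (G : ℚ) : R3_SRSumExpTail φ G :=
  fun x n s h hg t ht => SR.prob_dev_ge_le_exp_rat _ G x n s h hg t ht

/-- Combining with `R3_SRSpacing`: on a format of spacing `≤ G` the exponential tail needs only
`NoSat` (instances: E2M1 `G = 2`, E3M2 `4`, E2M3 `1/2`, E4M3 `32`, E5M2 `8192`). -/
theorem R3_SRSumExpTail_of_spacing {φ : Format} {G : ℚ} (hsp : R3_SRSpacing φ G)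
    (x : ℕ → ℚ) (n : ℕ) (s : ℚ) (h : SR.NoSat (valueSet φ) x n s) (t : ℚ) (ht : 0 < t) :
    ((SR.accExp (valueSet φ) x n (SR.devInd t (s + ∑ k ∈ range n, x k)) s : ℚ) : ℝ)
      ≤ 2 * Real.exp (-2 * (t : ℝ) ^ 2 / (n * (G : ℝ) ^ 2)) :=
  R3_SRSumExpTail_holds φ G x n s h (hsp x n s) t ht

/-! ### Two-stage SR inner products -/

/-- R3 (inner products by two-stage SR, `ŝₖ₊₁ = SR(ŝₖ + SR(cₖ))` with exact products `cₖ` and `2n`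
fresh roundings): if no branch saturates then `E_s ŝₙ = s + ∑cₖ` (CHM21 Thm 4.13, inner-product case,
finite format) and `E_s(ŝₙ − a)² = ipVar + (s + ∑cₖ − a)²`; if the product-rounding gaps are `≤ Gp`
and the sum-rounding gaps `≤ Gs` along the tree then `ipVar ≤ n(Gp² + Gs²)/4` and
`P(|ŝₙ − s − ∑cₖ| ≥ t) ≤ n(Gp² + Gs²)/(4t²)`.
PROVED (sr seat): `LowPrec.SR.ipExp_id_of_noSat`, `ipExp_sq_sub`, `ipVar_le`, `ipExp_prob_dev_ge_le`
(SRInnerProduct.lean). -/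
def R3_SRInnerProduct (φ : Format) (Gp Gs : ℚ) : Prop :=
  ∀ (c : ℕ → ℚ) (n : ℕ) (s : ℚ),
    (SR.IPNoSat (valueSet φ) c n s →
      SR.ipExp (valueSet φ) c n (fun t => t) s = s + ∑ k ∈ range n, c k ∧
      ∀ a : ℚ, SR.ipExp (valueSet φ) c n (fun t => (t - a) ^ 2) s
        = SR.ipVar (valueSet φ) c n s + (s + ∑ k ∈ range n, c k - a) ^ 2) ∧
    (SR.IPGapLE (valueSet φ) Gp Gs c n s →
      SR.ipVar (valueSet φ) c n s ≤ n * ((Gp ^ 2 + Gs ^ 2) / 4) ∧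
      (SR.IPNoSat (valueSet φ) c n s → ∀ t : ℚ, 0 < t →
        SR.ipExp (valueSet φ) c n (SR.devInd t (s + ∑ k ∈ range n, c k)) s
          ≤ n * ((Gp ^ 2 + Gs ^ 2) / 4) / t ^ 2))

/-- `R3_SRInnerProduct`: PROVED for every format and all `Gp, Gs`. -/
theorem R3_SRInnerProduct_holds (φ : Format) (Gp Gs : ℚ) : R3_SRInnerProduct φ Gp Gs :=
  fun c n s =>
    ⟨fun h => ⟨SR.ipExp_id_of_noSat _ n c s h, fun a => SR.ipExp_sq_sub _ n c s h a⟩,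
     fun hg => ⟨SR.ipVar_le _ Gp Gs n c s hg, fun h _ ht => SR.ipExp_prob_dev_ge_le _ Gp Gs c n s h hg ht⟩⟩

/-! ### Limited-randomness SR (IEEE P3109 StochasticA/B/C) -/

/-- R3 (limited randomness): with `N` random bits (P3109 interim report, modes StochasticA/B/C, exact
away-probabilities `⌊η2^N⌋/2^N`, `⌊η2^N + 1/2⌋/2^N`, `RNITE(η2^N)/2^N`), recursive SR summation is
biased, by at most `n·G·2^{-N}` (A) resp. `n·G·2^{-(N+1)}` (B, C) under `NoSat ∧ GapLE G` — against
exactly `0` for full-precision SR (`R3_SRSumUnbiased`).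
PROVED (sr seat): `LowPrec.SR.LimitedBits.stochasticA_bias_le`, `stochasticB_bias_le`,
`stochasticC_bias_le` (SRLimitedBits.lean; counts in SRLimitedBitsCounts.lean). -/
def R3_SRLimitedBitsBias (φ : Format) (N : ℕ) : Prop :=
  ∀ (G : ℚ) (x : ℕ → ℚ) (n : ℕ) (s : ℚ), SR.NoSat (valueSet φ) x n s → SR.GapLE (valueSet φ) G x n s →
    |SR.LimitedBits.accExpQ (valueSet φ) (SR.LimitedBits.probAwayA N) x n (fun t => t) s
        - (s + ∑ k ∈ range n, x k)| ≤ n * (1 / 2 ^ N * G) ∧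
    |SR.LimitedBits.accExpQ (valueSet φ) (SR.LimitedBits.probAwayB N) x n (fun t => t) s
        - (s + ∑ k ∈ range n, x k)| ≤ n * (1 / 2 ^ (N + 1) * G) ∧
    |SR.LimitedBits.accExpQ (valueSet φ) (SR.LimitedBits.probAwayC N) x n (fun t => t) s
        - (s + ∑ k ∈ range n, x k)| ≤ n * (1 / 2 ^ (N + 1) * G)

/-- `R3_SRLimitedBitsBias`: PROVED for every format and every `N`. -/
theorem R3_SRLimitedBitsBias_holds (φ : Format) (N : ℕ) : R3_SRLimitedBitsBias φ N :=
  fun _ x n s h hg =>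
    ⟨SR.LimitedBits.stochasticA_bias_le _ N x n s h hg, SR.LimitedBits.stochasticB_bias_le _ N x n s h hg,
     SR.LimitedBits.stochasticC_bias_le _ N x n s h hg⟩

end Summit.Ventures.CertifiedArithmetic
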